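import Summits.HubbardSuperconductivity.HubbardLadder.Bounds.CouplingPolymerGas
import Mathlib
import HarnessLib

/-!
# Smallness per bond for the weights of an abstract factorising Gibbs functional (K2 groundwork, part 5)

Helper file for route `TcThermcert1`, crux `ThermalStiffnessCeilingU8b10_le_1o8` (item `stmt-Ventures-26381`), line
`Cruxes/ThermalStiffnessCeilingU8b10_le_1o8/Lines/zerofree_corridor.lean` v9, registered stub K2 `stub_gcHighTempAnalytic`, step S4 of
`Cruxes/…/STUB-PLAN-stub_gcHighTempAnalytic.md`.

The GENERIC half of Ueltschi's weight estimate (tree: `Literature…HubbardPolymerBounds.norm_bondWeight_le`; cell pub-hubbard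
`Bounds/CouplingPolymerGas.norm_bondWeightC_le`), abstracted from `Zc β U μ` to any functional `T : (Bond Λ → ℂ) → ℂ` of the complex bond
couplings (companion of part 4, `TcThermcert1GcPolymerRepresentation`): the inclusion–exclusion bond weight
`M_c(K) = Σ_{K' ⊆ K} (−1)^{|K∖K'|} T(c|_{K'})/T(0)` is the iterated finite difference of the function `d ↦ T(d·ĉ)/T(0)` (`c = s ĉ`,
`weight_eq_iterDiff`), so the Cauchy bound for iterated differences of an entire function (`IteratedDifferenceBound.norm_iterDiff_zero_le`,
radius `1`) turns ANY activity bound of the shape `‖T(d)/T(0)‖ ≤ e^{‖Σ_b d_b T_b‖} · r^{|A|}` for couplings `d` on bonds inside `A`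
(hypothesis `hbound` — the model-specific input, for K2 the two-complex-fugacity activity bound of S4) into the smallness per bond
`‖M_c(K)‖ ≤ (e² s)^{|K|} · r^{|supp K|}` whenever `|c_b| ≤ s ≤ 1` (`norm_weight_le_of_activityBound`). Also: the entire dependence of
`c ↦ tr exp(X + Σ_b c_b T_b)` on the couplings for any fixed matrix `X` (`differentiable_trace_exp_add_hopSum`, pattern of
`differentiable_gibbsRatio`), which discharges the differentiability hypothesis for every Gibbs functional of that form (K2's has
`X = −βV_Λ(U,0) + F_Λ(ζ↑,ζ↓)`, part 3).

[cite: Ueltschi1999, §2.3 and §3 (|ρ(𝒜)| ≤ e^{-c|𝒜|} for small couplings)] Finite-dimensional analysis; no physics claim — nothing about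
superconductivity in the Hubbard model is proved by anything in this file. No definitions; no `sorry`.
-/

noncomputable section

namespace Summit.Ventures.CertifiedManyBodySolver.Theorems.TcThermcert1.ZeroFreeCorridor

open Matrix Finset Complex
open Literature.MathematicalPhysics.QuantumLattice Literature.Probability.LatticeModels Literature.Analysis.Complex.FiniteDifference
open Summit.HubbardSuperconductivity.HubbardLadder.Bounds
open scoped Matrix.Norms.L2Operator

variable {Λ : Type*} [LinearOrder Λ] [Fintype Λ]

/-- **Entire dependence on the couplings**: for any fixed matrix `X`, `c ↦ tr exp(X + Σ_b c_b T_b)` is complex-differentiable on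
`Bond Λ → ℂ` (pattern of `differentiable_gibbsRatio`). -/
theorem differentiable_trace_exp_add_hopSum (X : Matrix (Finset (Orb Λ)) (Finset (Orb Λ)) ℂ) :
    Differentiable ℂ (fun c : Bond Λ → ℂ => (NormedSpace.exp (X + hopSum c)).trace) := by
  have hlin : Differentiable ℂ (fun c : Bond Λ → ℂ => hopSum c) := by
    unfold hopSum
    fun_prop
  have hexp : Differentiable ℂ (fun Y : Matrix (Finset (Orb Λ)) (Finset (Orb Λ)) ℂ => NormedSpace.exp Y) :=
    fun Y => (NormedSpace.exp_analytic (𝕂 := ℂ) Y).differentiableAt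
  have htr : Differentiable ℂ (fun Y : Matrix (Finset (Orb Λ)) (Finset (Orb Λ)) ℂ => Y.trace) :=
    (Matrix.traceLinearMap (Finset (Orb Λ)) ℂ ℂ).toContinuousLinearMap.differentiable
  exact htr.comp (hexp.comp ((differentiable_const _).add hlin))

omit [LinearOrder Λ] in
/-- For `T` complex-differentiable in the couplings, so is `d ↦ T(d·ĉ)/T(0)`. -/
theorem differentiable_ratio_mul (T : (Bond Λ → ℂ) → ℂ) (hT : Differentiable ℂ T) (ĉ : Bond Λ → ℂ) :
    Differentiable ℂ (fun d : Bond Λ → ℂ => T (d * ĉ) / T 0) := by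
  simp_rw [div_eq_mul_inv]
  exact (hT.comp (differentiable_id.mul (differentiable_const ĉ))).mul_const _

omit [Fintype Λ] in
/-- **The bond weight is an iterated finite difference**: with step `s` in the coordinates of `K` at `0`, of `d ↦ T(d·ĉ)/T(0)`,
whenever `c = s ĉ` (pattern of `bondWeightC_eq_iterDiff`). -/
theorem weight_eq_iterDiff (T : (Bond Λ → ℂ) → ℂ) (c ĉ : Bond Λ → ℂ) (s : ℂ) (hcs : ∀ b, c b = s * ĉ b) (K : Finset (Bond Λ)) :
    (∑ K' ∈ K.powerset, (-1) ^ (K \ K').card * (T (restrictCoupling c K') / T 0)) =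
      iterDiff s K (fun d => T (d * ĉ) / T 0) 0 := by
  unfold iterDiff
  refine Finset.sum_congr rfl fun K' _ => ?_
  have hK' : restrictCoupling c K' = (0 + s • Set.indicator (↑K' : Set (Bond Λ)) 1) * ĉ := by
    funext b
    by_cases hb : b ∈ K' <;> simp [restrictCoupling_apply, hb, hcs]
  rw [hK']

/-- **Smallness per bond from an activity bound** (Cauchy bound for the iterated difference, radius `1`): if `T` is complex-differentiable
in the couplings and `‖T(d)/T(0)‖ ≤ e^{‖Σ_b d_b T_b‖} · r^{|A|}` for all couplings `d` on bonds inside any site set `A` (`hbound`), then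
for `|c_b| ≤ s ≤ 1` the inclusion–exclusion weight obeys `‖M_c(K)‖ ≤ (e² s)^{|K|} · r^{|supp K|}` (pattern of `norm_bondWeightC_le`). -/
theorem norm_weight_le_of_activityBound (T : (Bond Λ → ℂ) → ℂ) (hT : Differentiable ℂ T) {r : ℝ} (hr : 0 ≤ r)
    (hbound : ∀ (A : Finset Λ) (d : Bond Λ → ℂ), (∀ b, d b ≠ 0 → b.1 ∈ A ∧ b.2.1 ∈ A) →
      ‖T d / T 0‖ ≤ Real.exp ‖hopSum d‖ * r ^ A.card)
    (W : Finset (Bond Λ) → ℂ) {c : Bond Λ → ℂ}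
    (hW : ∀ K, W K = ∑ K' ∈ K.powerset, (-1) ^ (K \ K').card * (T (restrictCoupling c K') / T 0))
    {s : ℝ} (hs0 : 0 ≤ s) (hs1 : s ≤ 1) (hc : ∀ b, ‖c b‖ ≤ s) (K : Finset (Bond Λ)) :
    ‖W K‖ ≤ (Real.exp 2 * s) ^ K.card * r ^ (cellSupp Bond.verts K).card := by
  -- the normalised coupling `ĉ = c / s` (`0` if `s = 0`, in which case `c = 0`)
  set ĉ : Bond Λ → ℂ := fun b => if s = 0 then 0 else c b / s with hĉ
  have hcs : ∀ b, c b = (s : ℂ) * ĉ b := by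
    intro b
    by_cases h0 : s = 0
    · have hcb : c b = 0 := by
        have h := hc b
        rw [h0] at h
        exact norm_le_zero_iff.1 h
      simp [hĉ, h0, hcb]
    · have hs : (s : ℂ) ≠ 0 := Complex.ofReal_ne_zero.2 h0
      simp only [hĉ, if_neg h0]
      field_simp
  have hĉ1 : ∀ b, ‖ĉ b‖ ≤ 1 := by
    intro b
    by_cases h0 : s = 0
    · simp [hĉ, h0]
    · simp only [hĉ, if_neg h0, norm_div, Complex.norm_real, Real.norm_eq_abs, abs_of_nonneg hs0]
      exact div_le_one_of_le₀ (hc b) hs0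
  have hB : ∀ d : Bond Λ → ℂ, (∀ b, ‖d b‖ ≤ ‖(s : ℂ)‖ + 1) → (∀ b ∉ K, d b = 0) →
      ‖T (d * ĉ) / T 0‖ ≤ Real.exp (2 * K.card) * r ^ (cellSupp Bond.verts K).card := by
    intro d hd hK
    have hK' : ∀ b ∉ K, (d * ĉ) b = 0 := fun b hb => by rw [Pi.mul_apply, hK b hb, zero_mul]
    have hsupp : ∀ b, (d * ĉ) b ≠ 0 → b.1 ∈ cellSupp Bond.verts K ∧ b.2.1 ∈ cellSupp Bond.verts K := by
      intro b hb
      have hbK : b ∈ K := by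
        by_contra h
        exact hb (hK' b h)
      exact endpoints_mem_cellSupp hbK
    refine (hbound _ _ hsupp).trans (mul_le_mul_of_nonneg_right ?_ (pow_nonneg hr _))
    rw [Real.exp_le_exp]
    have hd2 : ∀ b, ‖(d * ĉ) b‖ ≤ 2 := by
      intro b
      rw [Pi.mul_apply, norm_mul]
      have h1 := hd b
      rw [Complex.norm_real, Real.norm_eq_abs, abs_of_nonneg hs0] at h1
      calc ‖d b‖ * ‖ĉ b‖ ≤ (s + 1) * 1 := mul_le_mul h1 (hĉ1 b) (norm_nonneg _) (by linarith)
        _ ≤ 2 := by linarith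
    refine (norm_hopSum_le_mul_card (s := 2) hd2 hK').trans (le_of_eq ?_)
    ring
  have h := norm_iterDiff_zero_le (differentiable_ratio_mul T hT ĉ) one_pos K hB
  rw [div_one, Complex.norm_real, Real.norm_eq_abs, abs_of_nonneg hs0] at h
  rw [hW, weight_eq_iterDiff T c ĉ s hcs K]
  refine h.trans (le_of_eq ?_)
  rw [mul_pow, ← Real.exp_nat_mul, mul_comm (K.card : ℝ) 2]
  ring

end Summit.Ventures.CertifiedManyBodySolver.Theorems.TcThermcert1.ZeroFreeCorridor

end
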